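import Summits.ResolutionOfSingularities.ResolutionOfSingularities.Theorems.FrobeniusClosingPatchingRelPerfectTwoPlanesChartsPi
import Summits.ResolutionOfSingularities.ResolutionOfSingularities.Theorems.FrobeniusClosingPatchingRelPerfectTwoPlanesRungJq
import Summits.ResolutionOfSingularities.ResolutionOfSingularities.Theorems.FrobeniusClosingPatchingRelPerfectTwoPlanesLevelTwoS
import HarnessLib

/-!
# Crux `PatchingRelPerfect` (stmt-ResolutionOfSingularities-16161), chain w52 — the rank-two member
# `f = x₀x₁ + x₂³`: chart `B₃`, ideal bookkeeping for the twice-repaired companion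

[OURS · L1 W5.2 · rung, design note NEXT-two-planes-cube.md Addendum 12, kit j288133]  With
`Q₀ = 𝔪ᴺ · A · J_q′ · J_π · A₃ · A₄` the image of `Q₀ · I` on `B₃ = S[x/x₃]` is
`(u)^{N+11} · ((J₃ · J_q♯ · K_π) · (u, e₀))` with `J_q♯ = (e₀) + u(e₁, e₂) + (u²)`,
`K_π = (e₀, u e₁, u e₂)² + (u³)` (`map_tpAllPi_three`).  On the two charts of the plane step
`Bl_{(u,e₀)}` (abstract `A`, `u, e₀, y, z₀`):

* `t`-chart: `J_q♯ ↦ (w)`, `K_π ↦ (w)²` — Cartier, so the companion is `(w)³ ·` the old flag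
  (`map_KK_t`);
* `s`-chart: `J_q♯ ↦ (w₀) · 𝔪_q`, `K_π ↦ (w₀)² · P_π`, `J₃ ↦ (w₀)³ (h″, w₀)²`, so the companion is
  `(w₀⁶) · ((P_π · (h″, w₀)²) · 𝔪_q)` — the input of `…TwoPlanesPointQCharts` (`map_KK_s`).

Any commutative rings; nothing here is a statement of the manuscript under review.

## References

* The Stacks Project, Tags 0804, 080B. [StacksProject]
-/

-- `Summit.<Summit>.<Sub>.Theorems` with `Sub = Summit` (single-conjunct summit, D-0017)
set_option linter.dupNamespace false

noncomputable section

open CategoryTheory CategoryTheory.Limits AlgebraicGeometry Literature.AlgebraicGeometry.Resolution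
open IsLocalRing

namespace Summit.ResolutionOfSingularities.ResolutionOfSingularities.Theorems

namespace TwoPlanesRung

open ConeRung

universe u

/-! ## Generic algebra -/

/-- Reordering the seven twisted factors of the twice-repaired companion on `B₃`. [folklore] -/
theorem tp_allPi_product {B : Type*} [CommRing B] (W P Q K X1 X2 X3 : Ideal B) (N : ℕ) :
    W ^ N * (W ^ 2 * P) * (W * Q) * (W ^ 2 * K) * (W ^ 2 * X1) * (W ^ 2 * X2) * (W ^ 2 * X3) =
      W ^ (N + 11) * ((X1 * X2 * X3 * Q * K) * P) := by
  ring

/-- Reordering on the `s`-chart. [folklore] -/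
theorem tp_point_product_s {B : Type*} [CommRing B] (W H MQ PP : Ideal B) :
    (W ^ 3 * H) * (W * MQ) * (W ^ 2 * PP) = W ^ 6 * ((PP * H) * MQ) := by
  ring

/-- The range of a four-member family `(w, s, a, b)`. [folklore] -/
theorem range_cons_three {A : Type*} (w s a b : A) :
    Set.range (Fin.cons w ![s, a, b] : Fin 4 → A) = {w, s, a, b} := by
  rw [Fin.range_cons, Matrix.range_cons, Matrix.range_cons, Matrix.range_cons, Matrix.range_empty,
    Set.union_empty, Set.singleton_union, Set.singleton_union]

/-! ## The plane charts: generic identities over a ring map -/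

section GenericPlane

variable {R B : Type*} [CommRing R] [CommRing B] (ψ : R →+* B) (uu e₀ y z₀ : R) (w t s y' z' : B)

local notation3 "Jq" => Ideal.span {e₀} ⊔ Ideal.span {uu} * Ideal.span {y, z₀} ⊔ Ideal.span {uu} ^ 2
local notation3 "Kpi" => Ideal.span {e₀, uu * y, uu * z₀} ^ 2 ⊔ Ideal.span {uu} ^ 3

/-- `t`-chart: `J_q♯ ↦ (w)` (`u ↦ w t`, `e₀ ↦ w`). [folklore] -/
theorem map_Jq_t_aux (hu : ψ uu = w * t) (he : ψ e₀ = w * 1) : (Jq).map ψ = Ideal.span {w} := by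
  have hw : w ∈ Ideal.span {w} := Ideal.mem_span_singleton_self _
  rw [Ideal.map_sup, Ideal.map_sup, Ideal.map_mul, Ideal.map_pow, Ideal.map_span, Set.image_singleton, he,
    mul_one, Ideal.map_span ψ {uu}, Set.image_singleton, hu]
  refine le_antisymm (sup_le (sup_le le_rfl (Ideal.mul_le_right.trans ?_)) ?_) (le_sup_of_le_left le_sup_left)
  · rw [Ideal.span_singleton_le_iff_mem]; exact Ideal.mul_mem_right _ _ hw
  · rw [Ideal.span_singleton_pow, Ideal.span_singleton_le_iff_mem, mul_pow, sq, mul_assoc]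
    exact Ideal.mul_mem_right _ _ hw

/-- `t`-chart: `(e₀, u y, u z₀) ↦ (w)`. [folklore] -/
theorem map_span_e_uy_uz_t_aux (hu : ψ uu = w * t) (he : ψ e₀ = w * 1) :
    (Ideal.span {e₀, uu * y, uu * z₀}).map ψ = Ideal.span {w} := by
  have hw : w ∈ Ideal.span {w} := Ideal.mem_span_singleton_self _
  rw [Ideal.map_span, Set.image_insert_eq, Set.image_insert_eq, Set.image_singleton, map_mul, map_mul, he, hu,
    mul_one]
  refine le_antisymm (Ideal.span_le.mpr (Set.insert_subset_iff.mpr ⟨hw, Set.insert_subset_iff.mpr ⟨?_,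
    Set.singleton_subset_iff.mpr ?_⟩⟩)) (Ideal.span_mono (Set.singleton_subset_iff.mpr (Set.mem_insert _ _)))
  · rw [SetLike.mem_coe, mul_assoc]; exact Ideal.mul_mem_right _ _ hw
  · rw [SetLike.mem_coe, mul_assoc]; exact Ideal.mul_mem_right _ _ hw

/-- `t`-chart: `K_π ↦ (w)²`. [folklore] -/
theorem map_Kpi_t_aux (hu : ψ uu = w * t) (he : ψ e₀ = w * 1) : (Kpi).map ψ = Ideal.span {w} ^ 2 := by
  rw [Ideal.map_sup, Ideal.map_pow, Ideal.map_pow, map_span_e_uy_uz_t_aux ψ uu e₀ y z₀ w t hu he, Ideal.map_span,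
    Set.image_singleton, hu]
  refine le_antisymm (sup_le le_rfl ?_) le_sup_left
  rw [Ideal.span_singleton_pow, Ideal.span_singleton_pow, Ideal.span_singleton_le_iff_mem]
  exact Ideal.mem_span_singleton'.mpr ⟨w * t ^ 3, by ring⟩

/-- **`t`-chart: `(J₃ · J_q♯ · K_π) ↦ (w³) · J₃`** for any ideal `J₃`. [folklore] -/
theorem map_KK_t_aux (hu : ψ uu = w * t) (he : ψ e₀ = w * 1) (J₃ : Ideal R) :
    (J₃ * Jq * Kpi).map ψ = Ideal.span {w ^ 3} * J₃.map ψ := by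
  rw [Ideal.map_mul, Ideal.map_mul, map_Jq_t_aux ψ uu e₀ y z₀ w t hu he, map_Kpi_t_aux ψ uu e₀ y z₀ w t hu he,
    Ideal.span_singleton_pow]
  have e : Ideal.span {w} * Ideal.span {w ^ 2} = Ideal.span {w ^ 3} := by
    rw [Ideal.span_singleton_mul_span_singleton, ← pow_succ']
  rw [mul_assoc, e, mul_comm]

/-- `s`-chart: `J_q♯ ↦ (w) · (w, s, y', z')` (`u ↦ w`, `e₀ ↦ w s`). [folklore] -/
theorem map_Jq_s_aux (hu : ψ uu = w * 1) (he : ψ e₀ = w * s) (hy : ψ y = y') (hz : ψ z₀ = z') :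
    (Jq).map ψ = Ideal.span {w} * Ideal.span {w, s, y', z'} := by
  rw [Ideal.map_sup, Ideal.map_sup, Ideal.map_mul, Ideal.map_pow, Ideal.map_span, Set.image_singleton, he,
    Ideal.map_span ψ {uu}, Set.image_singleton, hu, mul_one, Ideal.map_span, Set.image_pair, hy, hz,
    ← Ideal.span_singleton_mul_span_singleton, ← Ideal.mul_sup, sq, ← Ideal.mul_sup]
  have h4 : Ideal.span {w, s, y', z'} = Ideal.span {w} ⊔ (Ideal.span {s} ⊔ Ideal.span {y', z'}) := by
    rw [Ideal.span_insert, Ideal.span_insert]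
  rw [h4]
  congr 1
  ac_rfl

/-- `s`-chart: `K_π ↦ (w)² · ((w) + (s, y', z')²)`. [folklore] -/
theorem map_Kpi_s_aux (hu : ψ uu = w * 1) (he : ψ e₀ = w * s) (hy : ψ y = y') (hz : ψ z₀ = z') :
    (Kpi).map ψ = Ideal.span {w} ^ 2 * (Ideal.span {w} ⊔ Ideal.span {s, y', z'} ^ 2) := by
  have h3 : (Ideal.span {e₀, uu * y, uu * z₀}).map ψ = Ideal.span {w} * Ideal.span {s, y', z'} := by
    rw [Ideal.map_span, Set.image_insert_eq, Set.image_insert_eq, Set.image_singleton, map_mul, map_mul, he, hu,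
      hy, hz, mul_one, ConeRung.span_singleton_mul_span_triple]
  rw [Ideal.map_sup, Ideal.map_pow, Ideal.map_pow, h3, Ideal.map_span, Set.image_singleton, hu, mul_one, mul_pow,
    pow_succ _ 2, Ideal.mul_sup, sup_comm]

end GenericPlane

/-! ## The plane charts (abstract `A`) -/

section PlaneCharts

variable {A : Type u} [CommRing A] (uu e₀ y z₀ : A)

local notation3 "cc" => (Fin.cons uu (fun _ : Fin 1 => e₀) : Fin 2 → A)
/-- `J_q♯ = (e₀) + u (y, z₀) + (u²)` and `K_π = (e₀, u y, u z₀)² + (u³)` -/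
local notation3 "Jq" => Ideal.span {e₀} ⊔ Ideal.span {uu} * Ideal.span {y, z₀} ⊔ Ideal.span {uu} ^ 2
local notation3 "Kpi" => Ideal.span {e₀, uu * y, uu * z₀} ^ 2 ⊔ Ideal.span {uu} ^ 3
/-- the `t`-chart and the `s`-chart -/
local notation3 "ψ₁" => chartBase cc 1
local notation3 "w₁" => chartBase cc 1 (cc 1)
local notation3 "tt" => chartGen cc 1 0
local notation3 "ψ₀" => chartBase cc 0
local notation3 "w₀" => chartBase cc 0 (cc 0)
local notation3 "ss" => chartGen cc 0 1

/-- **`t`-chart: `(J₃ · J_q♯ · K_π) ↦ (w)³ · J₃`** for any ideal `J₃`. [cite: StacksProject, Tag 080B] -/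
theorem map_KK_t (J₃ : Ideal A) : (J₃ * Jq * Kpi).map ψ₁ = Ideal.span {w₁ ^ 3} * J₃.map ψ₁ :=
  map_KK_t_aux ψ₁ uu e₀ y z₀ w₁ tt (chartBase_one_u uu e₀) (chartBase_one_e uu e₀) J₃

/-- `s`-chart: `J_q♯ ↦ (w₀) · (w₀, s, y', z₀')` — the point `q`. [cite: StacksProject, Tag 080B] -/
theorem map_Jq_s : (Jq).map ψ₀ = Ideal.span {w₀} *
    Ideal.span (Set.range (Fin.cons w₀ ![ss, ψ₀ y, ψ₀ z₀] : Fin 4 → chartRing cc 0)) := by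
  rw [range_cons_three]
  exact map_Jq_s_aux ψ₀ uu e₀ y z₀ w₀ ss (ψ₀ y) (ψ₀ z₀) (chartBase_zero_u uu e₀) (chartBase_zero_e uu e₀) rfl rfl

/-- `s`-chart: `K_π ↦ (w₀)² · ((w₀) + (s, y', z₀')²)` — the plane avatar. [cite: StacksProject, Tag 080B] -/
theorem map_Kpi_s : (Kpi).map ψ₀ = Ideal.span {w₀} ^ 2 * (Ideal.span {w₀} ⊔ Ideal.span {ss, ψ₀ y, ψ₀ z₀} ^ 2) :=
  map_Kpi_s_aux ψ₀ uu e₀ y z₀ w₀ ss (ψ₀ y) (ψ₀ z₀) (chartBase_zero_u uu e₀) (chartBase_zero_e uu e₀) rfl rfl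

/-- `s`-chart: `J₃ ↦ (w₀)³ · (h″, w₀)²` (the three companion factors, `…LevelTwoS`).
[cite: StacksProject, Tag 080B] -/
theorem map_J_s :
    (Ideal.span {e₀ * y, uu} *
        (Ideal.span {e₀ * y + uu * z₀ ^ 3} ⊔ Ideal.span {uu} * Ideal.span {e₀} ⊔ Ideal.span {uu} ^ 2) *
        (Ideal.span {e₀ * y + uu * z₀ ^ 3} ⊔ Ideal.span {uu} ^ 2)).map ψ₀ =
      Ideal.span {w₀} ^ 3 * Ideal.span {ss * ψ₀ y + ψ₀ z₀ ^ 3, w₀} ^ 2 := by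
  rw [map_tpProd_s uu e₀ y (z₀ ^ 3), map_pow, sq (Ideal.span {ss * ψ₀ y + ψ₀ z₀ ^ 3, w₀})]
  exact congrArg (Ideal.span {w₀} ^ 3 * ·) (tp_flag_two _ _)

/-- **`s`-chart: `(J₃ · J_q♯ · K_π) ↦ (w₀⁶) · ((P_π · (h″, w₀)²) · 𝔪_q)`** — the input of the point
step. [cite: StacksProject, Tag 080B] -/
theorem map_KK_s :
    ((Ideal.span {e₀ * y, uu} *
        (Ideal.span {e₀ * y + uu * z₀ ^ 3} ⊔ Ideal.span {uu} * Ideal.span {e₀} ⊔ Ideal.span {uu} ^ 2) *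
        (Ideal.span {e₀ * y + uu * z₀ ^ 3} ⊔ Ideal.span {uu} ^ 2)) * Jq * Kpi).map ψ₀ =
      Ideal.span {w₀ ^ 6} * (((Ideal.span {w₀} ⊔ Ideal.span {ss, ψ₀ y, ψ₀ z₀} ^ 2) *
        Ideal.span {ss * ψ₀ y + ψ₀ z₀ ^ 3, w₀} ^ 2) *
        Ideal.span (Set.range (Fin.cons w₀ ![ss, ψ₀ y, ψ₀ z₀] : Fin 4 → chartRing cc 0))) := by
  have h1 := map_J_s uu e₀ y z₀
  have h2 := map_Jq_s uu e₀ y z₀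
  have h3 := map_Kpi_s uu e₀ y z₀
  rw [Ideal.map_mul, Ideal.map_mul, h1, h2, h3, ← Ideal.span_singleton_pow]
  exact tp_point_product_s _ _ _ _

end PlaneCharts

/-! ## The `S`-level image on `B₃` -/

section ChartThreeIdeals

variable {S : Type u} [CommRing S] (x : Fin 4 → S)

local notation3 (prettyPrint := false) "M" => Ideal.span (Set.range x)
local notation3 (prettyPrint := false) "fT" => x 0 * x 1 + x 2 ^ 3
local notation3 (prettyPrint := false) "φ" => chartBase x 3
local notation3 (prettyPrint := false) "uB" => chartBase x 3 (x 3)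
local notation3 (prettyPrint := false) "e[" j "]" => chartGen x 3 j
local notation3 (prettyPrint := false) "U" => Ideal.span {chartBase x 3 (x 3)}
local notation3 (prettyPrint := false) "II" => Ideal.span (Set.range
  (Fin.cons (chartBase x 3 (x 3)) (fun _ : Fin 1 => chartGen x 3 0) : Fin 2 → chartRing x 3))
local notation3 (prettyPrint := false) "J" => Ideal.span {chartGen x 3 0 * chartGen x 3 1, chartBase x 3 (x 3)} *
    (Ideal.span {chartGen x 3 0 * chartGen x 3 1 + chartBase x 3 (x 3) * chartGen x 3 2 ^ 3} ⊔
      Ideal.span {chartBase x 3 (x 3)} * Ideal.span {chartGen x 3 0} ⊔ Ideal.span {chartBase x 3 (x 3)} ^ 2) *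
    (Ideal.span {chartGen x 3 0 * chartGen x 3 1 + chartBase x 3 (x 3) * chartGen x 3 2 ^ 3} ⊔
      Ideal.span {chartBase x 3 (x 3)} ^ 2)
local notation3 (prettyPrint := false) "Jq₃" => Ideal.span {chartGen x 3 0} ⊔
  Ideal.span {chartBase x 3 (x 3)} * Ideal.span {chartGen x 3 1, chartGen x 3 2} ⊔ Ideal.span {chartBase x 3 (x 3)} ^ 2
local notation3 (prettyPrint := false) "Kpi₃" =>
  Ideal.span {chartGen x 3 0, chartBase x 3 (x 3) * chartGen x 3 1, chartBase x 3 (x 3) * chartGen x 3 2} ^ 2 ⊔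
    Ideal.span {chartBase x 3 (x 3)} ^ 3
local notation3 (prettyPrint := false) "tpJq'" => (Ideal.span {x 0} ⊔ Ideal.span {x 1, x 2} * Ideal.span {x 1, x 2, x 3} ⊔
  Ideal.span {x 3 ^ 3}) ⊔ Ideal.span (Set.range x) ^ 3
local notation3 (prettyPrint := false) "tpJpi" => Ideal.span {x 0, x 1 * x 3, x 2 * x 3} ^ 2 ⊔
  Ideal.span {x 0 * x 1 ^ 2, x 0 * x 2 ^ 2, x 1 ^ 4, x 2 ^ 4, x 3 ^ 5} ⊔ Ideal.span (Set.range x) ^ 5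

/-- `(x₁, x₂) B₃ = (u)(e₁, e₂)`. [cite: StacksProject, Tag 080B] -/
theorem map_span_x12_three : (Ideal.span {x 1, x 2}).map φ = U * Ideal.span {e[1], e[2]} := by
  rw [Ideal.map_span, Set.image_pair, reesChartBase_apply_eq_mul_chartGen x 3 1,
    reesChartBase_apply_eq_mul_chartGen x 3 2, ConeRung.span_singleton_mul_span_pair]

/-- `(x₁, x₂, x₃) B₃ = (u)`. [cite: StacksProject, Tag 080B] -/
theorem map_span_x123_three : (Ideal.span {x 1, x 2, x 3}).map φ = U := by
  have hu : uB ∈ U := Ideal.mem_span_singleton_self _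
  rw [Ideal.map_span, Set.image_insert_eq, Set.image_insert_eq, Set.image_singleton,
    reesChartBase_apply_eq_mul_chartGen x 3 1, reesChartBase_apply_eq_mul_chartGen x 3 2]
  refine le_antisymm (Ideal.span_le.mpr (Set.insert_subset_iff.mpr ⟨Ideal.mul_mem_right _ _ hu,
    Set.insert_subset_iff.mpr ⟨Ideal.mul_mem_right _ _ hu, Set.singleton_subset_iff.mpr hu⟩⟩))
    (Ideal.span_mono ?_)
  exact Set.singleton_subset_iff.mpr (Set.mem_insert_of_mem _ (Set.mem_insert_of_mem _ rfl))

/-- **`J_q′ B₃ = (u) · J_q♯`**, `J_q♯ = (e₀) + u(e₁, e₂) + (u²)`. [cite: StacksProject, Tag 080B] -/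
theorem map_chartBase_tpJq'_three : (tpJq').map φ = U * Jq₃ := by
  rw [Ideal.map_sup, Ideal.map_sup, Ideal.map_sup, Ideal.map_mul, map_chartBase_span_x0, map_span_x12_three,
    map_span_x123_three, Ideal.map_span, Set.image_singleton, map_pow, Ideal.map_pow, ConeRung.map_chartBase_M,
    ← Ideal.span_singleton_pow]
  have e3 : U ^ 3 = U * U ^ 2 := pow_succ' _ 2
  rw [e3, show U * Ideal.span {e[1], e[2]} * U = U * (U * Ideal.span {e[1], e[2]}) by ring, ← Ideal.mul_sup,
    ← Ideal.mul_sup, ← Ideal.mul_sup, sup_assoc, sup_idem]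

set_option maxHeartbeats 400000 in
/-- **`𝔪ᴺ·A·J_q′·J_π·A₃·A₄·I ↦ (u^{N+11})·((J₃ · J_q♯ · K_π) · (u, e₀))`** on `B₃`. [cite: StacksProject, Tag 080B] -/
theorem map_tpAllPi_three (N : ℕ) :
    (M ^ N * (Ideal.span {fT} ⊔ Ideal.span {x 0} * M ⊔ M ^ 3) * tpJq' * tpJpi * (Ideal.span {fT} ⊔ M ^ 3) *
        (Ideal.span {fT} ⊔ Ideal.span {x 0} * M ^ 2 ⊔ M ^ 4) * (Ideal.span {fT} ⊔ M ^ 4)).map φ =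
      Ideal.span {uB ^ (N + 11)} * ((J * Jq₃ * Kpi₃) * II) := by
  rw [Ideal.map_mul, Ideal.map_mul, Ideal.map_mul, Ideal.map_mul, Ideal.map_mul, Ideal.map_mul, Ideal.map_pow,
    ConeRung.map_chartBase_M, map_chartBase_tpA, map_chartBase_tpJq'_three, map_chartBase_tpJpi_three,
    map_chartBase_tpA3, map_chartBase_tpA4, map_chartBase_tpI, span_range_plane, ← Ideal.span_singleton_pow]
  exact tp_allPi_product U (Ideal.span {e[0], uB}) _ _ _ _ _ N

end ChartThreeIdeals

end TwoPlanesRung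

end Summit.ResolutionOfSingularities.ResolutionOfSingularities.Theorems

end
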